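import Summits.Ventures.Crystal3D.Theorems.StickyWulffConstantTextureLiminfTexShadowPresentationFlip
import HarnessLib

/-!
# TexShadow §2c (v6.14 proposal): the DEFICIENT part MINUS ALL PRESENTATION FLIPS, and the re-closed four-way glue
# (lane T, crux `TextureLiminf`, stmt-Ventures-19483; registered line `TexShadow` v6.13; cf-p1 g28/g29 INBOX 18:44:51Z, 20:04:01Z)

HONEST FRAMING. Venture `Summits/Ventures/Crystal3D` (cell `crystal3d-full`), helper `--supports` the crux `TextureLiminf`
(stmt-Ventures-19483) of `route-Ventures-StickyWulffConstant`, registered line `TexShadow`.  Rung credit only; F-C1 not moved.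
ONE definition (+ its `From` form) and the glue; nothing about the stubs.

THE POINT.  v6.13's `BilayerWallDeficit C R₀` asks the cell inequality for every pair whose GIVEN presentation is neither zig-dominated
nor row-mix-dominated — so every plate presented with `−−` layers (fcc with the all-`(−1)` word, the far half of a twin) falls to the
(L3) certificate road although its basal-mirror presentation `(M∘L, σ♭)`, `σ♭ n = −σ(−n−1)`, is `++` and is paid by the ROW F4.  By the
presentation-flip transport (`rowCov_flip₁/₂/₁₂`, `onReachAll_flip₁/₂`, `…PresentationFlip`) those pairs are ALREADY covered by the
row-covered / on-reach parts (which quantify over all presentations).  Hence: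

* `BilayerWallDeficitMin C R₀` — `BilayerWallDeficit` with THREE MORE HYPOTHESES: the table is not row-mix-dominated in the flipped
  presentation of plate 1, of plate 2, of both (tables re-indexed `c(−i−1) j`, `c i (−j−1)`, `c(−i−1)(−j−1)`); `BilayerWallDeficitMinFrom R`;
* `onReachAll_flip₁₂` — both plates flipped (complement of `…PresentationFlip`);
* **`bilayerWallGeneric_of_four_min`** — zig-covered ∪ row-covered ∪ on-reach ∪ deficit-MIN ⇒ generic (proved: v6.13's glue with three
  more `by_cases`, the new branches closed by the flip transports); `bilayerWallDeficitMin_of_deficit` — the v6.13 stub implies the new one.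
So v6.14 may REPLACE `stub_bilayerWallDeficit : ∃ R, BilayerWallDeficitFrom R` by `∃ R, BilayerWallDeficitMinFrom R` (strictly weaker
obligation: the certificate's universe loses every pair rescued by a flip) with `stub_bilayerWallGeneric` re-derived by
`bilayerWallGeneric_of_four_min` — a two-line swap.
WHAT THIS IS NOT: no claim about which pairs remain deficient after flips (plates with an h-layer or a `−−/++` mixture inside the
window, in row-steep orientations with weak zigzags: R45's hcp|hcp class); F-C1 not moved.
-/

noncomputable section

open scoped BigOperators InnerProductSpace ENNReal
open MeasureTheory Filter

namespace Summit.Ventures.Crystal3D.Cruxes.TextureLiminf.TexShadow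

open Summit.Ventures.Crystal3D Summit.Ventures.Crystal3D.Theorems
open Literature.MathematicalPhysics.StatisticalMechanics (basalMirror IsHaggSeq)

/-! ## The deficient part minus the flips -/

/-- **DEFICIENT PART MINUS ALL PRESENTATION FLIPS** at `(C, R₀)`: as `BilayerWallDeficit`, with the extra hypotheses that the table is
not row-mix-dominated (at `√2/2`) in the basal-mirror presentation of plate 1, of plate 2, and of both (re-indexed tables). -/
def BilayerWallDeficitMin (C R₀ : ℝ) : Prop :=
  ∀ (σ₁ σ₂ : ℤ → ℤ), IsHaggSeq σ₁ → IsHaggSeq σ₂ →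
    ∀ (L₁ L₂ : E3 ≃ₗᵢ[ℝ] E3) (s₁ s₂ : E3) (A₁ A₂ : ℤ → (E3 ≃ₗᵢ[ℝ] E3)) (u₁ u₂ : ℤ → E3),
    BilayerFramesAt L₁ s₁ σ₁ A₁ u₁ → BilayerFramesAt L₂ s₂ σ₂ A₂ u₂ →
    (∀ i j : ℤ, ¬ InResidualClass (A₁ i) (A₂ j) (u₁ i) (u₂ j)) →
    ∀ (c : ℤ → ℤ → ℝ) (m : ℤ → ℤ → E3), BilayerChargeAdmissible A₁ A₂ c m →
      ¬ (DeltaSteep L₁ e₃ ∧ DeltaSteep L₂ (-e₃) ∧ FluxDominated (Real.sqrt 2 / 2) L₁ σ₁ L₂ σ₂ c) →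
      ¬ RowMixDominated (Real.sqrt 2 / 2) L₁ σ₁ L₂ σ₂ c →
      ¬ RowMixDominated (Real.sqrt 2 / 2) (basalMirror.trans L₁) (fun n => -σ₁ (-n - 1)) L₂ σ₂ (fun i j => c (-i - 1) j) →
      ¬ RowMixDominated (Real.sqrt 2 / 2) L₁ σ₁ (basalMirror.trans L₂) (fun n => -σ₂ (-n - 1)) (fun i j => c i (-j - 1)) →
      ¬ RowMixDominated (Real.sqrt 2 / 2) (basalMirror.trans L₁) (fun n => -σ₁ (-n - 1))
          (basalMirror.trans L₂) (fun n => -σ₂ (-n - 1)) (fun i j => c (-i - 1) (-j - 1)) →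
      BilayerWallAt C R₀ σ₁ σ₂ L₁ L₂ s₁ s₂ c

/-- The deficit-min part holds FROM plate thickness `R` on. -/
def BilayerWallDeficitMinFrom (R : ℝ) : Prop := ∀ R₀ : ℝ, R ≤ R₀ → ∃ C : ℝ, BilayerWallDeficitMin C R₀

/-- The v6.13 deficient part implies the deficit-min part (the new stub is WEAKER). -/
theorem bilayerWallDeficitMin_of_deficit {C R₀ : ℝ} (h : BilayerWallDeficit C R₀) : BilayerWallDeficitMin C R₀ :=
  fun σ₁ σ₂ hσ₁ hσ₂ L₁ L₂ s₁ s₂ A₁ A₂ u₁ u₂ hu₁ hu₂ hgen c m hadm hZ hR _ _ _ =>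
    h σ₁ σ₂ hσ₁ hσ₂ L₁ L₂ s₁ s₂ A₁ A₂ u₁ u₂ hu₁ hu₂ hgen c m hadm hZ hR

/-- `From` form of the same implication. -/
theorem bilayerWallDeficitMinFrom_of_deficitFrom {R : ℝ} (h : BilayerWallDeficitFrom R) : BilayerWallDeficitMinFrom R :=
  fun R₀ hR₀ => (h R₀ hR₀).imp fun _ hC => bilayerWallDeficitMin_of_deficit hC

/-! ## Both plates flipped, on-reach -/

/-- **ON-REACH, both plates flipped.** -/
theorem onReachAll_flip₁₂ {OffR : (E3 ≃ₗᵢ[ℝ] E3) → E3 → (ℤ → ℤ) → (E3 ≃ₗᵢ[ℝ] E3) → E3 → (ℤ → ℤ) → Prop} {C R₀ : ℝ}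
    (hOR : BilayerWallOnReachAll OffR C R₀) {σ₁ σ₂ : ℤ → ℤ} (hσ₁ : IsHaggSeq σ₁) (hσ₂ : IsHaggSeq σ₂)
    {L₁ L₂ : E3 ≃ₗᵢ[ℝ] E3} {s₁ s₂ : E3} {A₁ A₂ : ℤ → (E3 ≃ₗᵢ[ℝ] E3)} {u₁ u₂ : ℤ → E3}
    (hF₁ : BilayerFramesAt L₁ s₁ σ₁ A₁ u₁) (hF₂ : BilayerFramesAt L₂ s₂ σ₂ A₂ u₂)
    (hres : ∀ i j : ℤ, ¬ InResidualClass (A₁ i) (A₂ j) (u₁ i) (u₂ j))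
    {c : ℤ → ℤ → ℝ} {m : ℤ → ℤ → E3} (hadm : BilayerChargeAdmissible A₁ A₂ c m)
    (hon : (DeltaSteep (basalMirror.trans L₁) e₃ ∧ DeltaSteep (basalMirror.trans L₂) (-e₃) ∧
        FluxDominated (Real.sqrt 2 / 2) (basalMirror.trans L₁) (fun n => -σ₁ (-n - 1))
          (basalMirror.trans L₂) (fun n => -σ₂ (-n - 1)) (fun i j => c (-i - 1) (-j - 1)) ∧
        ¬ BarlowOffReach (basalMirror.trans L₁) s₁ (fun n => -σ₁ (-n - 1)) (basalMirror.trans L₂) s₂ (fun n => -σ₂ (-n - 1))) ∨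
      (RowMixDominated (Real.sqrt 2 / 2) (basalMirror.trans L₁) (fun n => -σ₁ (-n - 1))
          (basalMirror.trans L₂) (fun n => -σ₂ (-n - 1)) (fun i j => c (-i - 1) (-j - 1)) ∧
        ¬ OffR (basalMirror.trans L₁) s₁ (fun n => -σ₁ (-n - 1)) (basalMirror.trans L₂) s₂ (fun n => -σ₂ (-n - 1)))) :
    BilayerWallAt C R₀ σ₁ σ₂ L₁ L₂ s₁ s₂ c :=
  bilayerWallAt_flip₁.1
    (onReachAll_flip₂ hOR (isHaggSeq_reverse hσ₁) hσ₂ (bilayerFramesAt_flip hF₁) hF₂ (fun _ _ => hres _ _)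
      (bilayerChargeAdmissible_flip₁ hadm) hon)

/-! ## The glue, re-closed -/

/-- **Glue (v6.14 proposal): zig-covered ∪ row-covered ∪ on-reach ∪ deficit-MIN ⇒ generic.**  As `bilayerWallGeneric_of_four`, the
three extra branches «row-mix-dominated after flipping plate 1 / plate 2 / both» being closed by `rowCov_flip…` (off-reach) or
`onReachAll_flip…` (not off-reach). -/
theorem bilayerWallGeneric_of_four_min
    {OffR : (E3 ≃ₗᵢ[ℝ] E3) → E3 → (ℤ → ℤ) → (E3 ≃ₗᵢ[ℝ] E3) → E3 → (ℤ → ℤ) → Prop}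
    {R_W R_R R_O R_D : ℝ} (hW1 : 1 ≤ R_W) (hW : BilayerWallWalkerCoveredFrom R_W)
    (hR : BilayerWallRowCovFrom OffR R_R) (hO : BilayerWallOnReachAllFrom OffR R_O) (hD : BilayerWallDeficitMinFrom R_D) :
    BilayerWallGenericFrom (max (max R_W R_R) (max R_O R_D)) := by
  classical
  intro R₀ hR₀
  have hR₀W : R_W ≤ R₀ := le_trans (le_trans (le_max_left _ _) (le_max_left _ _)) hR₀
  have hR₀R : R_R ≤ R₀ := le_trans (le_trans (le_max_right _ _) (le_max_left _ _)) hR₀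
  have hR₀O : R_O ≤ R₀ := le_trans (le_trans (le_max_left _ _) (le_max_right _ _)) hR₀
  have hR₀D : R_D ≤ R₀ := le_trans (le_trans (le_max_right _ _) (le_max_right _ _)) hR₀
  have hR₀0 : 0 ≤ R₀ := by linarith
  obtain ⟨C₁, hC₁⟩ := hW R₀ hR₀W
  obtain ⟨C₂, hC₂⟩ := hR R₀ hR₀R
  obtain ⟨C₃, hC₃⟩ := hO R₀ hR₀O
  obtain ⟨C₄, hC₄⟩ := hD R₀ hR₀D
  have h2 : C₂ ≤ max (max C₁ C₂) (max C₃ C₄) := le_trans (le_max_right _ _) (le_max_left _ _)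
  have h3 : C₃ ≤ max (max C₁ C₂) (max C₃ C₄) := le_trans (le_max_left _ _) (le_max_right _ _)
  refine ⟨max (max C₁ C₂) (max C₃ C₄), ?_⟩
  intro σ₁ σ₂ hσ₁ hσ₂ L₁ L₂ s₁ s₂ A₁ A₂ u₁ u₂ hu₁ hu₂ hgen c m hadm
  -- the row-or-on-reach dichotomy, for a presentation whose table is row-mix-dominated
  by_cases hZ : DeltaSteep L₁ e₃ ∧ DeltaSteep L₂ (-e₃) ∧ FluxDominated (Real.sqrt 2 / 2) L₁ σ₁ L₂ σ₂ c
  · by_cases hoff : BarlowOffReach L₁ s₁ σ₁ L₂ s₂ σ₂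
    · exact bilayerWallAt_mono hR₀0 (le_trans (le_max_left _ _) (le_max_left _ _))
        (hC₁ σ₁ σ₂ hσ₁ hσ₂ L₁ L₂ s₁ s₂ A₁ A₂ u₁ u₂ hu₁ hu₂ hgen ⟨hZ.1, hZ.2.1, hoff⟩ c m hadm hZ.2.2)
    · exact bilayerWallAt_mono hR₀0 h3
        (hC₃ σ₁ σ₂ hσ₁ hσ₂ L₁ L₂ s₁ s₂ A₁ A₂ u₁ u₂ hu₁ hu₂ hgen c m hadm (Or.inl ⟨hZ.1, hZ.2.1, hZ.2.2, hoff⟩))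
  · by_cases hRow : RowMixDominated (Real.sqrt 2 / 2) L₁ σ₁ L₂ σ₂ c
    · by_cases hoff : OffR L₁ s₁ σ₁ L₂ s₂ σ₂
      · exact bilayerWallAt_mono hR₀0 h2 (hC₂ σ₁ σ₂ hσ₁ hσ₂ L₁ L₂ s₁ s₂ A₁ A₂ u₁ u₂ hu₁ hu₂ hgen c m hadm hRow hoff)
      · exact bilayerWallAt_mono hR₀0 h3
          (hC₃ σ₁ σ₂ hσ₁ hσ₂ L₁ L₂ s₁ s₂ A₁ A₂ u₁ u₂ hu₁ hu₂ hgen c m hadm (Or.inr ⟨hRow, hoff⟩))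
    · by_cases hRow₁ : RowMixDominated (Real.sqrt 2 / 2) (basalMirror.trans L₁) (fun n => -σ₁ (-n - 1)) L₂ σ₂
          (fun i j => c (-i - 1) j)
      · by_cases hoff : OffR (basalMirror.trans L₁) s₁ (fun n => -σ₁ (-n - 1)) L₂ s₂ σ₂
        · exact bilayerWallAt_mono hR₀0 h2 (rowCov_flip₁ hC₂ hσ₁ hσ₂ hu₁ hu₂ hgen hadm hRow₁ hoff)
        · exact bilayerWallAt_mono hR₀0 h3 (onReachAll_flip₁ hC₃ hσ₁ hσ₂ hu₁ hu₂ hgen hadm (Or.inr ⟨hRow₁, hoff⟩))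
      · by_cases hRow₂ : RowMixDominated (Real.sqrt 2 / 2) L₁ σ₁ (basalMirror.trans L₂) (fun n => -σ₂ (-n - 1))
            (fun i j => c i (-j - 1))
        · by_cases hoff : OffR L₁ s₁ σ₁ (basalMirror.trans L₂) s₂ (fun n => -σ₂ (-n - 1))
          · exact bilayerWallAt_mono hR₀0 h2 (rowCov_flip₂ hC₂ hσ₁ hσ₂ hu₁ hu₂ hgen hadm hRow₂ hoff)
          · exact bilayerWallAt_mono hR₀0 h3 (onReachAll_flip₂ hC₃ hσ₁ hσ₂ hu₁ hu₂ hgen hadm (Or.inr ⟨hRow₂, hoff⟩))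
        · by_cases hRow₁₂ : RowMixDominated (Real.sqrt 2 / 2) (basalMirror.trans L₁) (fun n => -σ₁ (-n - 1))
              (basalMirror.trans L₂) (fun n => -σ₂ (-n - 1)) (fun i j => c (-i - 1) (-j - 1))
          · by_cases hoff : OffR (basalMirror.trans L₁) s₁ (fun n => -σ₁ (-n - 1)) (basalMirror.trans L₂) s₂
                (fun n => -σ₂ (-n - 1))
            · exact bilayerWallAt_mono hR₀0 h2 (rowCov_flip₁₂ hC₂ hσ₁ hσ₂ hu₁ hu₂ hgen hadm hRow₁₂ hoff)
            · exact bilayerWallAt_mono hR₀0 h3 (onReachAll_flip₁₂ hC₃ hσ₁ hσ₂ hu₁ hu₂ hgen hadm (Or.inr ⟨hRow₁₂, hoff⟩))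
          · exact bilayerWallAt_mono hR₀0 (le_trans (le_max_right _ _) (le_max_right _ _))
              (hC₄ σ₁ σ₂ hσ₁ hσ₂ L₁ L₂ s₁ s₂ A₁ A₂ u₁ u₂ hu₁ hu₂ hgen c m hadm hZ hRow hRow₁ hRow₂ hRow₁₂)

end Summit.Ventures.Crystal3D.Cruxes.TextureLiminf.TexShadow

end
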